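import Summits.QuantumAdvantage.QuantumAdvantage.Theorems.CubicForrelationNearExactIsExactTwelveLevelFive930GranularB
import Summits.QuantumAdvantage.QuantumAdvantage.Theorems.CubicForrelationNearExactIsExactTwelveLevelFiveHyperplaneGe2932
import Summits.QuantumAdvantage.QuantumAdvantage.Theorems.CubicForrelationNearExactIsExactTwelveLevelFive930Structure
import Summits.QuantumAdvantage.QuantumAdvantage.Theorems.CubicForrelationNearExactIsExactTwelveQuadSpectrumB

/-!
# Crux `CubicForrelation.NearExactIsExact` (stmt-QuantumAdvantage-14043) — n = 12, a level-5 side AT the boundary rung `Φ ≥ 29/32` with the pair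
  exact off the odd hyperplane: ROUND 1 of the cascade either FAILS rigidly (`e = σ(1 − 4·1_T)` on `P`, `#T = 128`, `Φ = 29/32`) or passes
  (`8 ∣ e − σ` on `P`)

Certificate seat `b2b-cforr-cert` (gen 22).  HONEST FRAMING: a kernel-checked structure DICHOTOMY (standard axioms, no `decide`) about cubic Boolean
pairs on 12 bits — the first step of `tw20_levelFive_gt2932_residual` (…TwelveLevelFiveResidualGt2932) ported from `Φ > 29/32` to `Φ ≥ 29/32`
under the hypothesis that the pair is exact off the odd hyperplane `P` (`u' = 2(−1)^f` wherever `u'` is even — automatic at `Φ > 29/32` by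
`tw20_off_flat_gt2932`; at `Φ = 29/32` the off-`P` energy can be exactly `1024`, a case NOT treated here).  At the boundary the budget
`Σ_P(e² − 1) ≤ 1024 = 8·2⁷` lets round 1 fail in exactly one way: `128` points of `P` with `(e − σ)/4` odd (`σ = (−1)^D`, `D` the quadratic digit
of `tw59_quadratic_digit`), each of cost exactly `8`, i.e. `e = −3σ` there and `e = σ` on the rest of `P`.  The second alternative feeds
…TwelveLevelFiveResidualGe2932.  Infrastructure for the boundary rung `29/32` (HOME/b2b-cforr-cert-g22/PLAN-N12-928-EQ.md); NOT summit progress,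
NO new value of `θ₁₂` claimed here.

References: J. Ax (1964) / R. J. McEliece (1972); MacWilliams–Sloane (1977) Ch. 13 §3, Ch. 15 §2; C. Carlet (2021) §4.1, §5.2.  Everything below
is proved from Mathlib and the tree; axioms are the standard three.
-/

set_option linter.dupNamespace false -- D-0017: single-problem summit ⇒ `QuantumAdvantage.QuantumAdvantage` by design

noncomputable section

namespace Summit.QuantumAdvantage.QuantumAdvantage.Theorems.CubicForrelation.NearExactIsExact

open Finset
open Literature.Computability.QuantumComplexity
open Literature.Computability.QuantumComplexity.BuzetChailloux (bxor zeroVec bxor_bxor_cancel_left bxor_zeroVec zeroVec_bxor bxor_comm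
  bxor_self twist_zeroVec_right twist_bxor_right)
open Literature.Computability.QuantumComplexity.DerivativeWalsh (W sum_W_sq twist_bxor_left card_mul_card_perp)
open Literature.Computability.QuantumComplexity.Simon (twist_eq_one_or twist_mul_self)

/-! ### Round 1 of the cascade at `Φ ≥ 29/32`, exact off the hyperplane -/

/-- **Round 1 of the level-5 cascade at `Φ ≥ 29/32` on 12 bits, exact off the odd hyperplane** (see the module docstring): with the quadratic
digit `D` (`4 ∣ e − (−1)^D` on the odd set, `e = u' − 2(−1)^f`), either the rigid boundary configuration (`e = (−1)^D` or `e = −3(−1)^D` on the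
odd set, the latter on exactly `128` points, `Φ = 29/32`), or `8 ∣ e − (−1)^D` on the odd set.  Finite-slice statement, NOT summit progress.
[this work] -/
theorem tw22_levelFive_ge2932_round1 (f g : (Fin (6 + 6) → Bool) → Bool) (hf : IsDegLeFun 3 f) (hg : IsDegLeFun 3 g)
    (u' : (Fin (6 + 6) → Bool) → ℤ) (hu' : ∀ x, W (fun y => signOf (g y)) x = (2 : ℝ) ^ 5 * (u' x : ℝ))
    (hodd : ∃ x, Odd (u' x)) (hΦ : (29 / 32 : ℝ) ≤ forrelation f g)
    (hoff : ∀ y, ¬ Odd (u' y) → u' y = 2 * sZ (f y)) :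
    (∃ (γ : Fin (6 + 6) → Bool) (tg : ℝ) (D : (Fin (6 + 6) → Bool) → Bool),
      (tg = 1 ∨ tg = -1) ∧ γ ≠ zeroVec ∧ (∀ x, (Odd (u' x) ↔ twist γ x = tg)) ∧ IsDegLeFun 2 D ∧
      (∀ x, Odd (u' x) → (u' x - 2 * sZ (f x) = sZ (D x) ∨ u' x - 2 * sZ (f x) = -3 * sZ (D x))) ∧
      #(univ.filter fun x : Fin (6 + 6) → Bool => Odd (u' x) ∧ u' x - 2 * sZ (f x) = -3 * sZ (D x)) = 128 ∧
      forrelation f g = 29 / 32) ∨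
    ∃ (γ : Fin (6 + 6) → Bool) (tg : ℝ) (D : (Fin (6 + 6) → Bool) → Bool),
      (tg = 1 ∨ tg = -1) ∧ γ ≠ zeroVec ∧ (∀ x, (Odd (u' x) ↔ twist γ x = tg)) ∧ IsDegLeFun 2 D ∧
      (∀ x, Odd (u' x) → (8 : ℤ) ∣ u' x - 2 * sZ (f x) - sZ (D x)) := by
  classical
  -- `u = 2u'` at the Ax level `4`; residual `e = u' − 2s`, budget `B = Σ e² = 2¹⁵(1 − Φ) ≤ 3072`
  set u : (Fin (6 + 6) → Bool) → ℤ := fun x => 2 * u' x with hudef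
  have hu : ∀ x, W (fun y => signOf (g y)) x = (2 : ℝ) ^ 4 * (u x : ℝ) := by
    intro x; rw [hu' x]; simp only [u]; push_cast; ring
  set e : (Fin (6 + 6) → Bool) → ℤ := fun x => u' x - 2 * sZ (f x) with hedef
  have hbud := tw12_budget f g u hu
  have h4e : ∀ x, (u x - 4 * sZ (f x)) ^ 2 = 4 * e x ^ 2 := fun x => by simp only [u, e]; ring
  have hBR : ((∑ x, e x ^ 2 : ℤ) : ℝ) = 32768 * (1 - forrelation f g) := by
    have h' : ((∑ x, (u x - 4 * sZ (f x)) ^ 2 : ℤ) : ℝ) = 4 * ((∑ x, e x ^ 2 : ℤ) : ℝ) := by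
      rw [sum_congr rfl fun x _ => h4e x, ← mul_sum]; push_cast; ring
    rw [h'] at hbud
    linarith
  have hB_le : (∑ x, e x ^ 2 : ℤ) ≤ 3072 := by
    have h' : ((∑ x, e x ^ 2 : ℤ) : ℝ) ≤ 3072 := by rw [hBR]; linarith
    exact_mod_cast h'
  -- off the hyperplane the pair is exact (hypothesis `hoff`)
  have he0 : ∀ y, ¬ Odd (u' y) → e y = 0 := fun y hy => by
    show u' y - 2 * sZ (f y) = 0
    rw [hoff y hy]; ring
  -- the odd hyperplane `P = x₀ ⊕ V` and the quadratic digit `D`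
  obtain ⟨γ, tg, htg, hγ0, hPg⟩ := tw22_hyperplane_ge2932 f g hg u' hu' hodd hΦ
  obtain ⟨i, hγi⟩ := tw59_exists_coord γ hγ0
  obtain ⟨D, hD, hDig⟩ := tw59_quadratic_digit f g hg u' hu' γ tg hPg i hγi hoff
  set P := univ.filter (fun x : Fin (6 + 6) → Bool => Odd (u' x)) with hPdef
  have hmemP : ∀ x, x ∈ P ↔ Odd (u' x) := fun x => by simp [hPdef]
  have hmemP' : ∀ x, x ∈ P ↔ twist γ x = tg := fun x => by rw [hmemP, hPg]
  set V := univ.filter (fun a : Fin (6 + 6) → Bool => twist γ a = 1) with hVdef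
  have hVmem : ∀ a, a ∈ V ↔ twist γ a = 1 := fun a => by rw [hVdef, mem_filter]; simp
  have hV0 : zeroVec ∈ V := (hVmem _).2 (twist_zeroVec_right γ)
  have hVadd : ∀ x ∈ V, ∀ y ∈ V, bxor x y ∈ V := by
    intro x hx y hy; rw [hVmem] at hx hy ⊢; rw [twist_bxor_right, hx, hy, mul_one]
  have hVcard : #V = 2 ^ 11 := by rw [hVdef, tw59_card_half γ hγ0 1 (Or.inl rfl)]; norm_num
  obtain ⟨x₀, hx₀⟩ := id hodd
  have hx₀P : x₀ ∈ P := (hmemP x₀).2 hx₀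
  have hPimg : P = V.image (bxor x₀) := tw59_eq_image P V γ tg hmemP' hVmem x₀ hx₀P
  have hPV : ∀ x, x ∈ P → ∀ a ∈ V, bxor x a ∈ P := fun x hx a ha => fl1_coset_vadd hVadd hPimg hx ha
  have hcardP : #P = 2048 := by
    have e1 : P = univ.filter (fun x : Fin (6 + 6) → Bool => twist γ x = tg) := by
      ext x; rw [hmemP', mem_filter]; simp
    rw [e1]; exact tw59_card_half γ hγ0 tg htg
  -- cost accounting on `P`
  have heodd : ∀ x, x ∈ P → Odd (e x) := by
    intro x hx
    exact Int.odd_sub.2 (iff_of_true ((hmemP x).1 hx) ⟨sZ (f x), two_mul _⟩)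
  have hsq1 : ∀ x, x ∈ P → 1 ≤ e x ^ 2 := by
    intro x hx
    have h0 := Int.odd_iff.1 (heodd x hx)
    have : e x ≤ -1 ∨ 1 ≤ e x := by omega
    have := tp_sq_ge (k := 1) (by norm_num) this
    linarith
  have hsplit : (∑ x, e x ^ 2 : ℤ) = ∑ x ∈ P, e x ^ 2 :=
    (sum_subset (subset_univ P) fun x _ hx => by
      rw [he0 x (fun h => hx ((hmemP x).2 h))]; ring).symm
  have hPsum : ∑ x ∈ P, e x ^ 2 ≤ 3072 := by rw [← hsplit]; exact hB_le
  have hcost : ∀ (T : Finset (Fin (6 + 6) → Bool)) (c : ℤ), T ⊆ P → (∀ x ∈ T, c ≤ e x ^ 2 - 1) → c * #T ≤ 1024 := by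
    intro T c hT hc
    have h1 : c * #T ≤ ∑ x ∈ T, (e x ^ 2 - 1) := by
      calc c * #T = ∑ x ∈ T, c := by rw [sum_const, nsmul_eq_mul, mul_comm]
        _ ≤ ∑ x ∈ T, (e x ^ 2 - 1) := sum_le_sum hc
    have h2 : ∑ x ∈ T, (e x ^ 2 - 1) ≤ ∑ x ∈ P, (e x ^ 2 - 1) :=
      sum_le_sum_of_subset_of_nonneg hT fun x hx _ => by linarith [hsq1 x hx]
    have h3 : ∑ x ∈ P, (e x ^ 2 - 1) = ∑ x ∈ P, e x ^ 2 - 2048 := by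
      rw [sum_sub_distrib, sum_const, hcardP]; norm_num
    linarith
  -- flat sums of `e = u' − 2s`: `8 ∣` on 5-flats, `16 ∣` on 7-flats, `32 ∣` on 10-flats
  have hflat : ∀ (k c : ℕ) (M : ℤ), (2 : ℤ) ^ (c + 1) = 2 * M → 4 + (c + 1) ≤ k + (6 + 6 - k + 2) / 3 → M ∣ 2 * 2 ^ ((k + 2) / 3) →
      ∀ (b : Fin (6 + 6) → Bool) (a : Fin k → Fin (6 + 6) → Bool),
      M ∣ ∑ ε : Fin k → Bool, e (fun j => b j ^^ decide (Odd #(univ.filter fun i => ε i && a i j))) := by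
    intro k c M hM hk hM' b a
    have h1 := fs_flat_sum_dvd (e := c + 1) g u hg hu b a hk
    obtain ⟨zf, hzf⟩ := sl_sum_sZ_flat f hf b a
    have hzf' : ∑ ε : Fin k → Bool, 2 * sZ (f (fun j => b j ^^ decide (Odd #(univ.filter fun i => ε i && a i j)))) =
        2 * 2 ^ ((k + 2) / 3) * zf := by
      rw [← mul_sum, hzf, ← mul_assoc]
    have h1' : 2 * M ∣ 2 * ∑ ε : Fin k → Bool, u' (fun j => b j ^^ decide (Odd #(univ.filter fun i => ε i && a i j))) := by
      rw [← hM, mul_sum]; exact h1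
    have h1'' : M ∣ ∑ ε : Fin k → Bool, u' (fun j => b j ^^ decide (Odd #(univ.filter fun i => ε i && a i j))) :=
      (mul_dvd_mul_iff_left two_ne_zero).1 h1'
    have h3 : ∑ ε : Fin k → Bool, e (fun j => b j ^^ decide (Odd #(univ.filter fun i => ε i && a i j))) =
        ∑ ε : Fin k → Bool, u' (fun j => b j ^^ decide (Odd #(univ.filter fun i => ε i && a i j))) -
        ∑ ε : Fin k → Bool, 2 * sZ (f (fun j => b j ^^ decide (Odd #(univ.filter fun i => ε i && a i j)))) := by
      rw [← sum_sub_distrib]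
    rw [h3, hzf']
    exact dvd_sub h1'' (dvd_mul_of_dvd_left hM' _)
  have hflat5 := hflat 5 3 8 (by norm_num) (by norm_num) (by norm_num)
  -- flat sums of the quadratic sign `σ = (−1)^D`: `8 ∣`, `16 ∣`, `32 ∣`
  have hquad5 : ∀ (b : Fin (6 + 6) → Bool) (a : Fin 5 → Fin (6 + 6) → Bool),
      (8 : ℤ) ∣ ∑ ε : Fin 5 → Bool, sZ (D (fun j => b j ^^ decide (Odd #(univ.filter fun i => ε i && a i j)))) := by
    intro b a; have h := tw15_quad_flat_sum D hD b a; rw [show (2 : ℤ) ^ ((5 + 1) / 2) = 8 by norm_num] at h; exact h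
  -- combined: the flat sums of `e − σ`
  have hcomb : ∀ (k : ℕ) (M : ℤ),
      (∀ (b : Fin (6 + 6) → Bool) (a : Fin k → Fin (6 + 6) → Bool),
        M ∣ ∑ ε : Fin k → Bool, e (fun j => b j ^^ decide (Odd #(univ.filter fun i => ε i && a i j)))) →
      (∀ (b : Fin (6 + 6) → Bool) (a : Fin k → Fin (6 + 6) → Bool),
        M ∣ ∑ ε : Fin k → Bool, sZ (D (fun j => b j ^^ decide (Odd #(univ.filter fun i => ε i && a i j))))) →
      ∀ (b : Fin (6 + 6) → Bool) (a : Fin k → Fin (6 + 6) → Bool),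
        M ∣ ∑ ε : Fin k → Bool, (e (fun j => b j ^^ decide (Odd #(univ.filter fun i => ε i && a i j))) -
          sZ (D (fun j => b j ^^ decide (Odd #(univ.filter fun i => ε i && a i j))))) := by
    intro k M he hD' b a
    rw [sum_sub_distrib]
    exact dvd_sub (he b a) (hD' b a)
  have hcomb5 := hcomb 5 8 hflat5 hquad5
  -- on `P`: `4 ∣ e − σ`
  have hdig4 : ∀ x, x ∈ P → (4 : ℤ) ∣ e x - sZ (D x) := fun x hx => hDig x ((hmemP x).1 hx)
  -- ONE ROUND of wild-point parity on `P`: if `q ∣ e − σ` on `P`, the flat layer gives `2q ∣` on flats, and odd quotients are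
  -- too expensive, then `2q ∣ e − σ` on `P`
  have hptcost : ∀ (q c : ℤ), 2 ≤ q → (q - 1) ^ 2 - 1 = c → ∀ x, x ∈ P → q ∣ e x - sZ (D x) → Odd ((e x - sZ (D x)) / q) →
      c ≤ e x ^ 2 - 1 := by
    intro q c hq hc x hx hdiv hoddq
    have hq' : e x - sZ (D x) = q * ((e x - sZ (D x)) / q) := (Int.mul_ediv_cancel' hdiv).symm
    set t := (e x - sZ (D x)) / q with ht
    have ht1 : t ≤ -1 ∨ 1 ≤ t := by have := Int.odd_iff.1 hoddq; omega
    have hs := tp_sZ_cases (D x)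
    have key : e x ≤ -(q - 1) ∨ q - 1 ≤ e x := by
      rcases ht1 with ht1 | ht1
      · left
        have : q * t ≤ q * (-1) := mul_le_mul_of_nonneg_left ht1 (by linarith)
        rcases hs with hs | hs <;> rw [hs] at hq' <;> linarith
      · right
        have : q * 1 ≤ q * t := mul_le_mul_of_nonneg_left ht1 (by linarith)
        rcases hs with hs | hs <;> rw [hs] at hq' <;> linarith
    have := tp_sq_ge (k := q - 1) (by linarith) key
    linarith
  have hsumP1 : ∑ x ∈ P, (e x ^ 2 - 1) ≤ 1024 := by
    have h3 : ∑ x ∈ P, (e x ^ 2 - 1) = ∑ x ∈ P, e x ^ 2 - 2048 := by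
      rw [sum_sub_distrib, sum_const, hcardP]; norm_num
    linarith
  have hq4' : ∀ y, y ∈ P → e y - sZ (D y) = 4 * ((e y - sZ (D y)) / 4) := fun y hy => (Int.mul_ediv_cancel' (hdig4 y hy)).symm
  /- ROUND 1 AT THE BOUNDARY: either `8 ∣ e − σ` on `P`, or exactly `128` points of `P` carry an odd quotient `(e − σ)/4`, each of cost `8` -/
  by_cases hA : ∃ x, x ∈ P ∧ Odd ((e x - sZ (D x)) / 4)
  · left
    set T := P.filter (fun x => Odd ((e x - sZ (D x)) / 4)) with hTdef
    have hTP : T ⊆ P := filter_subset _ _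
    rcases ws_erm_round V hV0 hVadd hVcard x₀ (fun y => (e y - sZ (D y)) / 4) 4 (fun b hb a ha => by
        have hbP : b ∈ P := by rw [hPimg]; exact hb
        have hpts : ∀ ε : Fin (4 + 1) → Bool, (fun j => b j ^^ decide (Odd #(univ.filter fun i => ε i && a i j))) ∈ P :=
          fun ε => ws_flatPt_mem V hV0 (· ∈ P) hPV (4 + 1) b hbP a ha ε
        have h := hcomb5 b a
        rw [sum_congr rfl fun ε _ => hq4' _ (hpts ε), ← mul_sum] at h
        exact (mul_dvd_mul_iff_left (by norm_num : (4 : ℤ) ≠ 0)).1 (by rw [show (4 : ℤ) * 2 = 8 by norm_num]; exact h)) with hev | hbig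
    · exfalso
      obtain ⟨x, hx, hxo⟩ := hA
      obtain ⟨k, hk⟩ := hev x (by rw [← hPimg]; exact hx)
      have h0 := Int.odd_iff.1 hxo
      omega
    rw [← hPimg] at hbig
    change 2 ^ 11 ≤ 2 ^ 4 * #T at hbig
    have hTge : 128 ≤ #T := by norm_num at hbig; omega
    have hT8 : ∀ x ∈ T, 8 ≤ e x ^ 2 - 1 := fun x hx =>
      hptcost 4 8 (by norm_num) (by norm_num) x (hTP hx) (hdig4 x (hTP hx)) (mem_filter.1 hx).2
    have hTle : 8 * (#T : ℤ) ≤ 1024 := hcost T 8 hTP hT8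
    have hTcard : #T = 128 := by
      have : (#T : ℤ) ≤ 128 := by linarith
      have : #T ≤ 128 := by exact_mod_cast this
      omega
    -- the cost split over `T` and `P ∖ T`
    have hdecomp : ∑ x ∈ P, (e x ^ 2 - 1) = ∑ x ∈ T, (e x ^ 2 - 1) +
        ∑ x ∈ P.filter (fun x => ¬ Odd ((e x - sZ (D x)) / 4)), (e x ^ 2 - 1) :=
      (sum_filter_add_sum_filter_not P _ _).symm
    have hTsum : 8 * (#T : ℤ) ≤ ∑ x ∈ T, (e x ^ 2 - 1) := by
      calc 8 * (#T : ℤ) = ∑ x ∈ T, (8 : ℤ) := by rw [sum_const, nsmul_eq_mul, mul_comm]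
        _ ≤ ∑ x ∈ T, (e x ^ 2 - 1) := sum_le_sum hT8
    have hrest_nn : 0 ≤ ∑ x ∈ P.filter (fun x => ¬ Odd ((e x - sZ (D x)) / 4)), (e x ^ 2 - 1) :=
      sum_nonneg fun x hx => by linarith [hsq1 x (mem_filter.1 hx).1]
    rw [hTcard] at hTsum
    push_cast at hTsum
    have hTsumeq : ∑ x ∈ T, (e x ^ 2 - 1) = 1024 := by linarith
    have hrest0 : ∑ x ∈ P.filter (fun x => ¬ Odd ((e x - sZ (D x)) / 4)), (e x ^ 2 - 1) = 0 := by linarith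
    -- pointwise: cost exactly `8` on `T`, exactly `0` on `P ∖ T`
    have hTpt : ∀ x ∈ T, e x ^ 2 = 9 := by
      intro x hx
      by_contra hne
      have hgt : 9 ≤ e x ^ 2 - 1 := by have := hT8 x hx; omega
      have hrest : 8 * (127 : ℤ) ≤ ∑ y ∈ T.erase x, (e y ^ 2 - 1) := by
        calc 8 * (127 : ℤ) = ∑ y ∈ T.erase x, (8 : ℤ) := by rw [sum_const, nsmul_eq_mul, card_erase_of_mem hx, hTcard]; norm_num
          _ ≤ ∑ y ∈ T.erase x, (e y ^ 2 - 1) := sum_le_sum fun y hy => hT8 y (mem_of_mem_erase hy)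
      have := Finset.sum_erase_add T (fun y => e y ^ 2 - 1) hx
      linarith
    have hPTpt : ∀ x ∈ P, x ∉ T → e x ^ 2 = 1 := by
      intro x hxP hxT
      have hmem : x ∈ P.filter (fun x => ¬ Odd ((e x - sZ (D x)) / 4)) := mem_filter.2 ⟨hxP, fun h => hxT (mem_filter.2 ⟨hxP, h⟩)⟩
      have h := (sum_eq_zero_iff_of_nonneg fun y hy => by linarith [hsq1 y (mem_filter.1 hy).1]).1 hrest0 x hmem
      linarith
    -- `e = σ` or `e = −3σ` on `P`
    have hform : ∀ x, x ∈ P → (e x = sZ (D x) ∧ x ∉ T) ∨ (e x = -3 * sZ (D x) ∧ x ∈ T) := by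
      intro x hxP
      obtain ⟨k, hk⟩ := hdig4 x hxP
      rcases tp_sZ_cases (D x) with hs | hs
      · by_cases hxT : x ∈ T
        · right
          refine ⟨?_, hxT⟩
          have h9 := hTpt x hxT
          have hprod : (e x - 3) * (e x + 3) = 0 := by ring_nf; linarith
          rcases mul_eq_zero.1 hprod with h | h
          · exfalso; rw [hs] at hk; omega
          · rw [hs]; linarith
        · left
          refine ⟨?_, hxT⟩
          have h1 := hPTpt x hxP hxT
          have hprod : (e x - 1) * (e x + 1) = 0 := by ring_nf; linarith
          rcases mul_eq_zero.1 hprod with h | h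
          · rw [hs]; linarith
          · exfalso; rw [hs] at hk; omega
      · by_cases hxT : x ∈ T
        · right
          refine ⟨?_, hxT⟩
          have h9 := hTpt x hxT
          have hprod : (e x - 3) * (e x + 3) = 0 := by ring_nf; linarith
          rcases mul_eq_zero.1 hprod with h | h
          · rw [hs]; linarith
          · exfalso; rw [hs] at hk; omega
        · left
          refine ⟨?_, hxT⟩
          have h1 := hPTpt x hxP hxT
          have hprod : (e x - 1) * (e x + 1) = 0 := by ring_nf; linarith
          rcases mul_eq_zero.1 hprod with h | h
          · exfalso; rw [hs] at hk; omega
          · rw [hs]; linarith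
    have hσne : ∀ x, sZ (D x) ≠ -3 * sZ (D x) := fun x h => by rcases tp_sZ_cases (D x) with hs | hs <;> rw [hs] at h <;> norm_num at h
    refine ⟨γ, tg, D, htg, hγ0, hPg, hD, fun x hx => ?_, ?_, ?_⟩
    · rcases hform x ((hmemP x).2 hx) with ⟨h, -⟩ | ⟨h, -⟩
      · left; simp only [e] at h; exact h
      · right; simp only [e] at h; exact h
    · have hset : (univ.filter fun x : Fin (6 + 6) → Bool => Odd (u' x) ∧ u' x - 2 * sZ (f x) = -3 * sZ (D x)) = T := by
        ext x
        rw [mem_filter]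
        constructor
        · rintro ⟨-, hxo, hxe⟩
          rcases hform x ((hmemP x).2 hxo) with ⟨h, -⟩ | ⟨-, hT⟩
          · exfalso; simp only [e] at h; exact hσne x (h.symm.trans hxe)
          · exact hT
        · intro hxT
          refine ⟨mem_univ _, (hmemP x).1 (hTP hxT), ?_⟩
          rcases hform x (hTP hxT) with ⟨-, hn⟩ | ⟨h, -⟩
          · exact absurd hxT hn
          · simp only [e] at h; exact h
      rw [hset, hTcard]
    · -- `Σ e² = 3072` exactly
      have hPsum' : ∑ x ∈ P, e x ^ 2 = 3072 := by
        have h3 : ∑ x ∈ P, (e x ^ 2 - 1) = ∑ x ∈ P, e x ^ 2 - 2048 := by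
          rw [sum_sub_distrib, sum_const, hcardP]; norm_num
        rw [hdecomp, hTsumeq, hrest0] at h3
        linarith
      have h : ((∑ x, e x ^ 2 : ℤ) : ℝ) = 3072 := by rw [hsplit, hPsum']; norm_num
      rw [hBR] at h
      linarith
  right
  exact ⟨γ, tg, D, htg, hγ0, hPg, hD, fun x hx => by
    have hxP : x ∈ P := (hmemP x).2 hx
    have hne : ¬ Odd ((e x - sZ (D x)) / 4) := fun h => hA ⟨x, hxP, h⟩
    obtain ⟨k, hk⟩ := Int.not_odd_iff_even.1 hne
    exact ⟨k, by simp only [e] at hq4' hk ⊢; rw [hq4' x hxP, hk]; ring⟩⟩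

end Summit.QuantumAdvantage.QuantumAdvantage.Theorems.CubicForrelation.NearExactIsExact

end
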